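/-
Origin: expansion seat `prover-pub-hodgecm-mc-carch-1-0`, handover #CA9 2026-08-20T00:25Z md5 378700afe6aa (187 l.; NEW additive leaf; imports Model.ArchKTypeOfLines (#CA3), Model.ArchKTypeOfFrameMatch (#CA8); RUN 38; INSTALL after #CA3,#CA8; cert certs/ax-ArchKTypeOfOmega-378700afe6aa.log: RUN-37 mirror world rc 0 / 0 warnings / 15/15 trio) (`HOME/mc/pub-hodgecm-mc-carch-1/pkg38/HodgeCM/Model/ArchKTypeOfOmega.lean`, md5 378700afe6aa, 187 lines);
landed by the second packager (p2) in gate run 38 as `HodgeCM/Model/ArchKTypeOfOmega.lean` (verbatim).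
-/
/-
Copyright (c) 2026. Released under Apache 2.0 license as described in the file LICENSE.
Cell pub-hodgecm, MODEL layer (construction prover mc-carch-1, gen 0), BINDER-OWNERS row 12 `C`: the honest archimedean factor
`ωA_k : Representation ℂ U(2,1) 𝓢((Fin 3 → L⁺_∞), ℂ)` of line `k` with its two junctions `hA` (#CA3 `Model/ArchKTypeOfLines`) and
`hωA` (#CA8 `Model/ArchKTypeOfFrameMatch`) DISCHARGED.
-/
import Summits.HodgeConjecture.HodgeCM.Model.ArchKTypeOfLines
import Summits.HodgeConjecture.HodgeCM.Model.ArchKTypeOfFrameMatch_2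

-- G11b-3 recipe (port D30 slow-export class; ops-buildfix LEDGER B13-1/B13-3): elaborate sequentially so the trailing
-- `attribute [implicit_reducible]` block (reducibilityCoreExt is keyed to the async environment branch) is in force at `.olean` export.
set_option Elab.async false

/-!
# The honest `ωA_k` of row 12 and its junctions `hA`, `hωA`

* § 1 `Representation.smulPull χ ρ f : u ↦ χ u • ρ (f u)` — a character-twisted pullback of a representation (generic).
* § 2 at the S pin of record: **`lineOmega_k := smulPull (lineScalar_k) (cmArchWeilRep e₁ hGR_k) (archSectionFrameOf V, 1)`**
  (`k = 0, 1, 2, 3`), and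
  **`lineRepOf_k_archInfOf_eq` (`hA`)**: `lineRepOf k (archInfOf V u, 1) = adelicTensorEnd (lineOmega_k u) LinearMap.id` (#CA3);
  **`lineOmega_k_twistU21_expP` (`hωA` along `ec := twistU21 L ι₁ ∘ expP`)**:
  `lineOmega_k (twistU21 (expP b)) = cmArchWeilRep e₁ hGR_k (cmBlockSection (frameD V) (lineVec (d k)) eP eQ (u21FrameEquiv (expP b), 1))`
  for the canonical `eP = blockPosEquiv V`, `eQ = blockNegEquiv V` — the line scalar dies on `twistU21 (exp 𝔭)` because
  `lineScalar_k ∘ twistU21` is again a character of `U(2,1)` (`map_expP_eq_one`), and the frame matching is #CA8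
  `cmBlockSection_u21FrameEquiv`.
Nothing is cited and nothing is minted: one generic definition, four explicit operators, kernel lemmas.
-/

set_option autoImplicit false

noncomputable section

open NumberField NumberField.mixedEmbedding IsDedekindDomain
open scoped Matrix TensorProduct Classical SchwartzMap
open Literature.Geometry.ComplexHyperbolic.BallModel (U21)
open Literature.AlgebraicGeometry.ShimuraVarieties.BallForms (expP)
open Literature.RepresentationTheory.KonnoKonno2007 (map_expP_eq_one)
open Literature.RepresentationTheory.KonnoKonno2007.RealDualPair
open Literature.NumberTheory.Automorphic Literature.NumberTheory.Weil1964
open Literature.NumberTheory.GelbartRogawski1991 Literature.NumberTheory.GelbartRogawski1991.UnitaryDualPair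
open HodgeCM.Adelic HodgeCM.PerL34 HodgeCM.Model.HypCensus

/-! ## § 1 Character-twisted pullback of a representation -/

namespace Representation

variable {G H X : Type*} [Monoid G] [Monoid H] [AddCommMonoid X] [Module ℂ X]

/-- `u ↦ χ u • ρ (f u)`: the pullback of `ρ` along `f`, twisted by the character `χ`. -/
def smulPull (χ : G →* ℂˣ) (ρ : Representation ℂ H X) (f : G →* H) : Representation ℂ G X where
  toFun u := ((χ u : ℂˣ) : ℂ) • ρ (f u)
  map_one' := by rw [map_one, map_one, map_one, Units.val_one, one_smul]
  map_mul' u v := by rw [map_mul, map_mul, map_mul, Units.val_mul, mul_smul_mul_comm]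

/-- unfolding `smulPull`. -/
@[simp] theorem smulPull_apply (χ : G →* ℂˣ) (ρ : Representation ℂ H X) (f : G →* H) (u : G) :
    smulPull χ ρ f u = ((χ u : ℂˣ) : ℂ) • ρ (f u) := rfl

end Representation

namespace HodgeCM.Model

namespace ArchSideTerm

variable {L : CMField} {ι₁ : L →+* ℂ} (V : HermSpace3 L ι₁) (S : StubTree.SeesawDatum L)

variable
  (hGR : (cmSplittingDatum (L : Type) finProdFinEquiv (frameD V) (frameD_real V) (frameD_ne V) (dW S) (dW_real S) (dW_ne S)).CompatibleSplitting)
  (hGR₀ : (cmSplittingDatum (L : Type) (e₁) (frameD V) (frameD_real V) (frameD_ne V) (lineVec (L : Type) (dW S 0))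
    (fun _ => dW_real S 0) (fun _ => dW_ne S 0)).CompatibleSplitting)
  (hGR₁ : (cmSplittingDatum (L : Type) (e₁) (frameD V) (frameD_real V) (frameD_ne V) (lineVec (L : Type) (dW S 1))
    (fun _ => dW_real S 1) (fun _ => dW_ne S 1)).CompatibleSplitting)
  (hGR₂ : (cmSplittingDatum (L : Type) (e₁) (frameD V) (frameD_real V) (frameD_ne V) (lineVec (L : Type) (dW' S 0))
    (fun _ => dW'_real S 0) (fun _ => dW'_ne S 0)).CompatibleSplitting)
  (hGR₃ : (cmSplittingDatum (L : Type) (e₁) (frameD V) (frameD_real V) (frameD_ne V) (lineVec (L : Type) (dW' S 1))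
    (fun _ => dW'_real S 1) (fun _ => dW'_ne S 1)).CompatibleSplitting)
  (η₀ η₁ η₂ η₃ : CMAdelic (L : Type) (frameD V) × CMAdelicOne (L : Type) →* ℂˣ)

/-! ## § 2 The honest archimedean factors of the four lines -/

/-- **`ωA_0`**: `u ↦ c_0(u) • cmArchWeilRep e₁ hGR_0 (archSectionFrameOf V u, 1)`. -/
def lineOmega_zero : Representation ℂ U21 𝓢((Fin 3 → mixedSpace (↥(maximalRealSubfield L))), ℂ) :=
  Representation.smulPull (lineScalar_zero V S hGR hGR₀ hGR₁ η₀)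
    (cmArchWeilRep (L : Type) e₁ (frameD V) (frameD_real V) (frameD_ne V) (lineVec (L : Type) (dW S 0))
      (fun _ => dW_real S 0) (fun _ => dW_ne S 0) hGR₀)
    (MonoidHom.prod (archSectionFrameOf V) 1)

/-- **`ωA_1`**. -/
def lineOmega_one : Representation ℂ U21 𝓢((Fin 3 → mixedSpace (↥(maximalRealSubfield L))), ℂ) :=
  Representation.smulPull (lineScalar_one V S hGR hGR₀ hGR₁ η₁)
    (cmArchWeilRep (L : Type) e₁ (frameD V) (frameD_real V) (frameD_ne V) (lineVec (L : Type) (dW S 1))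
      (fun _ => dW_real S 1) (fun _ => dW_ne S 1) hGR₁)
    (MonoidHom.prod (archSectionFrameOf V) 1)

/-- **`ωA_2`**. -/
def lineOmega_two : Representation ℂ U21 𝓢((Fin 3 → mixedSpace (↥(maximalRealSubfield L))), ℂ) :=
  Representation.smulPull (lineScalar_two V S hGR hGR₂ hGR₃ η₂)
    (cmArchWeilRep (L : Type) e₁ (frameD V) (frameD_real V) (frameD_ne V) (lineVec (L : Type) (dW' S 0))
      (fun _ => dW'_real S 0) (fun _ => dW'_ne S 0) hGR₂)
    (MonoidHom.prod (archSectionFrameOf V) 1)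

/-- **`ωA_3`**. -/
def lineOmega_three : Representation ℂ U21 𝓢((Fin 3 → mixedSpace (↥(maximalRealSubfield L))), ℂ) :=
  Representation.smulPull (lineScalar_three V S hGR hGR₂ hGR₃ η₃)
    (cmArchWeilRep (L : Type) e₁ (frameD V) (frameD_real V) (frameD_ne V) (lineVec (L : Type) (dW' S 1))
      (fun _ => dW'_real S 1) (fun _ => dW'_ne S 1) hGR₃)
    (MonoidHom.prod (archSectionFrameOf V) 1)

/-! ### `hA`: the read-off identities -/

/-- **`hA` for line 0.** -/
theorem lineRepOf_zero_archInfOf_eq (hV : IsAnisotropic L V.Hm) (u : U21) :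
    lineRepOf V S hGR hGR₀ hGR₁ hGR₂ hGR₃ η₀ η₁ η₂ η₃ 0 (archInfOf V u, 1) =
      adelicTensorEnd (K := ↥(maximalRealSubfield L)) (ι := Fin 3) (lineOmega_zero V S hGR hGR₀ hGR₁ η₀ u) LinearMap.id :=
  lineRepOf_zero_archInfOf_one V S hGR hGR₀ hGR₁ hGR₂ hGR₃ η₀ η₁ η₂ η₃ hV u

/-- **`hA` for line 1.** -/
theorem lineRepOf_one_archInfOf_eq (hV : IsAnisotropic L V.Hm) (u : U21) :
    lineRepOf V S hGR hGR₀ hGR₁ hGR₂ hGR₃ η₀ η₁ η₂ η₃ 1 (archInfOf V u, 1) =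
      adelicTensorEnd (K := ↥(maximalRealSubfield L)) (ι := Fin 3) (lineOmega_one V S hGR hGR₀ hGR₁ η₁ u) LinearMap.id :=
  lineRepOf_one_archInfOf_one V S hGR hGR₀ hGR₁ hGR₂ hGR₃ η₀ η₁ η₂ η₃ hV u

/-- **`hA` for line 2.** -/
theorem lineRepOf_two_archInfOf_eq (hV : IsAnisotropic L V.Hm) (u : U21) :
    lineRepOf V S hGR hGR₀ hGR₁ hGR₂ hGR₃ η₀ η₁ η₂ η₃ 2 (archInfOf V u, 1) =
      adelicTensorEnd (K := ↥(maximalRealSubfield L)) (ι := Fin 3) (lineOmega_two V S hGR hGR₂ hGR₃ η₂ u) LinearMap.id :=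
  lineRepOf_two_archInfOf_one V S hGR hGR₀ hGR₁ hGR₂ hGR₃ η₀ η₁ η₂ η₃ hV u

/-- **`hA` for line 3.** -/
theorem lineRepOf_three_archInfOf_eq (hV : IsAnisotropic L V.Hm) (u : U21) :
    lineRepOf V S hGR hGR₀ hGR₁ hGR₂ hGR₃ η₀ η₁ η₂ η₃ 3 (archInfOf V u, 1) =
      adelicTensorEnd (K := ↥(maximalRealSubfield L)) (ι := Fin 3) (lineOmega_three V S hGR hGR₂ hGR₃ η₃ u) LinearMap.id :=
  lineRepOf_three_archInfOf_one V S hGR hGR₀ hGR₁ hGR₂ hGR₃ η₀ η₁ η₂ η₃ hV u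

/-! ### `hωA`: the frame matching along `twistU21 ∘ expP` -/

/-- a character of `U(2,1)` dies on `twistU21 (exp 𝔭)`. -/
theorem map_twistU21_expP_eq_one (χ : U21 →* ℂˣ) (b : Fin 2 → ℂ) : χ (twistU21 L ι₁ (expP b)) = 1 :=
  map_expP_eq_one (χ.comp (twistU21 L ι₁)) b

/-- **`hωA` for line 0** (canonical `eP`, `eQ`; chart `twistU21 ∘ expP`). -/
theorem lineOmega_zero_twistU21_expP (b : Fin 2 → ℂ) :
    lineOmega_zero V S hGR hGR₀ hGR₁ η₀ (twistU21 L ι₁ (expP b)) =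
      cmArchWeilRep (L : Type) e₁ (frameD V) (frameD_real V) (frameD_ne V) (lineVec (L : Type) (dW S 0))
        (fun _ => dW_real S 0) (fun _ => dW_ne S 0) hGR₀
        (cmBlockSection (L : Type) (frameD V) (frameD_real V) (frameD_ne V) (lineVec (L : Type) (dW S 0))
          (fun _ => dW_real S 0) (fun _ => dW_ne S 0) ι₁ (blockPosEquiv V) (blockNegEquiv V)
          (((u21FrameEquiv (expP b) : UForm (Fin 2) Unit), (1 : UForm _ _)) : Ginf (Fin 2) Unit _ _)) := by
  rw [lineOmega_zero, Representation.smulPull_apply, map_twistU21_expP_eq_one, Units.val_one, one_smul,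
    cmBlockSection_u21FrameEquiv]
  rfl

/-- **`hωA` for line 1.** -/
theorem lineOmega_one_twistU21_expP (b : Fin 2 → ℂ) :
    lineOmega_one V S hGR hGR₀ hGR₁ η₁ (twistU21 L ι₁ (expP b)) =
      cmArchWeilRep (L : Type) e₁ (frameD V) (frameD_real V) (frameD_ne V) (lineVec (L : Type) (dW S 1))
        (fun _ => dW_real S 1) (fun _ => dW_ne S 1) hGR₁
        (cmBlockSection (L : Type) (frameD V) (frameD_real V) (frameD_ne V) (lineVec (L : Type) (dW S 1))
          (fun _ => dW_real S 1) (fun _ => dW_ne S 1) ι₁ (blockPosEquiv V) (blockNegEquiv V)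
          (((u21FrameEquiv (expP b) : UForm (Fin 2) Unit), (1 : UForm _ _)) : Ginf (Fin 2) Unit _ _)) := by
  rw [lineOmega_one, Representation.smulPull_apply, map_twistU21_expP_eq_one, Units.val_one, one_smul,
    cmBlockSection_u21FrameEquiv]
  rfl

/-- **`hωA` for line 2.** -/
theorem lineOmega_two_twistU21_expP (b : Fin 2 → ℂ) :
    lineOmega_two V S hGR hGR₂ hGR₃ η₂ (twistU21 L ι₁ (expP b)) =
      cmArchWeilRep (L : Type) e₁ (frameD V) (frameD_real V) (frameD_ne V) (lineVec (L : Type) (dW' S 0))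
        (fun _ => dW'_real S 0) (fun _ => dW'_ne S 0) hGR₂
        (cmBlockSection (L : Type) (frameD V) (frameD_real V) (frameD_ne V) (lineVec (L : Type) (dW' S 0))
          (fun _ => dW'_real S 0) (fun _ => dW'_ne S 0) ι₁ (blockPosEquiv V) (blockNegEquiv V)
          (((u21FrameEquiv (expP b) : UForm (Fin 2) Unit), (1 : UForm _ _)) : Ginf (Fin 2) Unit _ _)) := by
  rw [lineOmega_two, Representation.smulPull_apply, map_twistU21_expP_eq_one, Units.val_one, one_smul,
    cmBlockSection_u21FrameEquiv]
  rfl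

/-- **`hωA` for line 3.** -/
theorem lineOmega_three_twistU21_expP (b : Fin 2 → ℂ) :
    lineOmega_three V S hGR hGR₂ hGR₃ η₃ (twistU21 L ι₁ (expP b)) =
      cmArchWeilRep (L : Type) e₁ (frameD V) (frameD_real V) (frameD_ne V) (lineVec (L : Type) (dW' S 1))
        (fun _ => dW'_real S 1) (fun _ => dW'_ne S 1) hGR₃
        (cmBlockSection (L : Type) (frameD V) (frameD_real V) (frameD_ne V) (lineVec (L : Type) (dW' S 1))
          (fun _ => dW'_real S 1) (fun _ => dW'_ne S 1) ι₁ (blockPosEquiv V) (blockNegEquiv V)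
          (((u21FrameEquiv (expP b) : UForm (Fin 2) Unit), (1 : UForm _ _)) : Ginf (Fin 2) Unit _ _)) := by
  rw [lineOmega_three, Representation.smulPull_apply, map_twistU21_expP_eq_one, Units.val_one, one_smul,
    cmBlockSection_u21FrameEquiv]
  rfl


end ArchSideTerm

end HodgeCM.Model
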